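import Literature.NumberTheory.Rogawski1990.UnramifiedStableOrbitalUnitFactorSemisimple
import Literature.NumberTheory.Rogawski1990.SingularEllipticTransferCanonical
import Literature.NumberTheory.Rogawski1990.AnisotropicUnitarySemisimple
import Literature.NumberTheory.Automorphic.GodementHeightFloor
import HarnessLib

/-!
# The κ-constant of the singular local transfer identity is `1` at almost every place — P4 `stub_kappaConst_ae_one` of the «#88 side»
(Rogawski, *Automorphic Representations of Unitary Groups in Three Variables* (1990), §4.9 Prop. 4.9.1 (b) p. 55, §8.2 Prop. 8.2.1 (a) pp. 117–118,
§8.3 Prop. 8.3.1 p. 121, §14.5 Lemma 14.5.2 (b) p. 239; Kottwitz, *Stable trace formula: elliptic singular terms* (1986), Prop. 7.1, Cor. 7.3)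

Topic `NumberTheory/Rogawski1990`; namespace `Literature.NumberTheory.Rogawski1990`.  THEOREMS ONLY: no definition, no named fact, no instance, no notation,
no `sorry`.  Cell `pub/hodgecm-mathlib`, ENGINE T1 (crux H413 = `stmt-HodgeConjecture-24833`), the «#88 side» = pay-down of ★ `SingularEllipticTransferCanonical`
(line T6-L5 `Cruxes/H413/Lines/F0_P3a_SingularEllipticTransferPaydown.lean`, ED. 2 = CUT B; LEAD DESK WORDS T6-20 (4), T6-21 (3), T6-22 (B)); the payable
**P4 `stub_kappaConst_ae_one`** of `CENSUS-88-kappaMass` §4 (F0P3a-p08 (g9)); seat F0P3a-p04 (g9).  Brick: ★ `UnramifiedStableOrbitalUnitFactorSemisimple` (p830017).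

THE POINT.  ED. 2 of the line replaces the (κ-MASS) clause of ★ `SingularEllipticTransfer` (:256) by three print letters inside the members' `∃`; the local
one, (κ-loc) [Prop. 8.2.1 (a); L. 14.5.2 (b) p. 239: «`Δ_{G∕H}(γ₀) Φ^κ(γ₀, f_v) = f^H_v(γ₀)`»], reads: for some `c : v ↦ ℂ`, at EVERY finite `v` and every smooth
`Δ_v`-transfer pair `f_v → f^H_v` of the REGULAR data `(Δ, m_H, m_G)`,
`Φ^st_v((γ₀)_v, f_v; mGs v) = c_v · f^H_v((γ_H)_v)` (★ `localStableOrbitalIntegral`, the singular members `mGs`).  Print adds «`c_v = +1` for almost all `v`»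
(§4.9 p. 55 (3); Prop. 8.3.1).  THAT clause is NOT a letter: it FOLLOWS from (κ-loc), the unit fundamental lemma off `S_bad` (★ `IsLocalUnitTransfer`, a conjunct
of ★ `CanonicalTransferMatrix`) and the normalisation of the singular members — evaluate (κ-loc) at the unit pair `(1_{K_{H,v}}, 1_{K′_v})`:
* LHS `= Φ^st_v((γ₀)_v, 1_{K′_v}; mGs v) = 1` for almost every `v` — ★ `eventually_localStableOrbitalIntegral_indicator_eq_one_of_isSemisimpleElt` (the base class
  carries the unit factor `1` by ★ `IsNormalisedOff`, every other class of the local stable class carries `0` by Kottwitz 7.1; `γ₀` is semisimple because `U(H′)` is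
  anisotropic, ★ `isSemisimpleElt_of_anisotropic`);
* RHS `= c_v · 1_{K_{H,v}}((γ_H)_v) = c_v` for almost every `v` — a rational point is integral at almost every place (★ `eventually_toLocal_mem_cmLocalIntegralLevel`).
Hence `c_v = 1` off a finite set `S_c`.

* §1 `isLocSmooth_indicator_prod_cmLocalIntegralLevel` — the unit `1_{U(Φ₂)(𝒪_v) × U(Φ₁)(𝒪_v)}` of `H_v` is a test function (★ `isLocSmooth_indicator_subgroup`).
* §2 **`kappaConst_ae_one`** — the closer, with the unit fundamental lemma as the clause `∀ v ∉ Sbad, IsLocalUnitTransfer …` and the (κ-loc) letter in the shape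
  fixed by P3's consumer text (F0P3a-p07 (g4), `SingularKappaMassGlue`: `∀ v fH f, IsLocSmooth f → IsLocSmooth fH → IsLocalDeltaTransfer … fH f → Φ^st_v = c v * fH (γ_H)_v`).
* §3 **`kappaConst_ae_one_of_canonicalTransferMatrix`** — the same over the line's binder `hCTM : CanonicalTransferMatrix L H′ Tinf.Δ νH νG Sbad Δ mH mG` VERBATIM.

HC_CM is proved only modulo the printed citations until rung 0 closes; this file consumes nothing printed (it REMOVES the a.e.-clause [Prop. 8.3.1] from the
letter (κ-loc) of the #88 side).

## References
* [Rogawski1990] J. D. Rogawski, *Automorphic Representations of Unitary Groups in Three Variables*, Ann. of Math. Stud. 123 (1990), §4.9 Prop. 4.9.1 (b)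
  p. 55; §8.2 Prop. 8.2.1 (a) pp. 117–118; §8.3 Prop. 8.3.1 p. 121; §14.5 Lemma 14.5.2 (b) p. 239.
* [Kottwitz1986] R. E. Kottwitz, *Stable trace formula: elliptic singular terms*, Math. Ann. 275 (1986), Prop. 7.1, Cor. 7.3.
-/

set_option autoImplicit false

noncomputable section

open NumberField IsDedekindDomain Filter Function MeasureTheory
open scoped Matrix MatrixGroups

namespace Literature.NumberTheory.Rogawski1990

open Literature.NumberTheory.Automorphic Literature.MeasureTheory.Group
open Literature.AlgebraicGeometry.ShimuraVarieties (unitaryGroup hermForm)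

/-! ## §1 The unit of `H_v = U(Φ₂)(L⁺_v) × U(Φ₁)(L⁺_v)` is a test function -/

section Unit

variable (L : Type) [Field L] [NumberField L] [IsCMField L] (v : HeightOneSpectrum (𝓞 ↥(maximalRealSubfield L)))

/-- **`1_{U(Φ₂)(𝒪_v) × U(Φ₁)(𝒪_v)} ∈ C_c^∞(H_v)`**: the indicator of the product of the integral levels (a compact open subgroup of the product local group,
★ `isCompact_isOpen_cmLocalIntegralLevel` ×2) is locally constant with compact support (★ `isLocSmooth_indicator_subgroup`) — the `H`-side function of the
unit fundamental lemma ★ `IsLocalUnitTransfer`. [cite: Rogawski1990, §4.9 Prop. 4.9.1 (b) p. 55] -/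
theorem isLocSmooth_indicator_prod_cmLocalIntegralLevel :
    IsLocSmooth ((((UnitaryGroup.cmLocalIntegralLevel L 2 (Matrix.of fun i j : Fin 2 => if i.val + j.val + 1 = 2 then (1 : L) else 0) v).prod
        (UnitaryGroup.cmLocalIntegralLevel L 1 (Matrix.of fun i j : Fin 1 => if i.val + j.val + 1 = 1 then (1 : L) else 0) v) :
          Subgroup ((UnitaryGroup.cmDatum L 2 (Matrix.of fun i j : Fin 2 => if i.val + j.val + 1 = 2 then (1 : L) else 0)).Local v ×
            (UnitaryGroup.cmDatum L 1 (Matrix.of fun i j : Fin 1 => if i.val + j.val + 1 = 1 then (1 : L) else 0)).Local v)) :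
        Set ((UnitaryGroup.cmDatum L 2 (Matrix.of fun i j : Fin 2 => if i.val + j.val + 1 = 2 then (1 : L) else 0)).Local v ×
          (UnitaryGroup.cmDatum L 1 (Matrix.of fun i j : Fin 1 => if i.val + j.val + 1 = 1 then (1 : L) else 0)).Local v)).indicator
      fun _ => (1 : ℂ)) := by
  have h₂ := UnitaryGroup.isCompact_isOpen_cmLocalIntegralLevel L 2 (Matrix.of fun i j : Fin 2 => if i.val + j.val + 1 = 2 then (1 : L) else 0) v
  have h₁ := UnitaryGroup.isCompact_isOpen_cmLocalIntegralLevel L 1 (Matrix.of fun i j : Fin 1 => if i.val + j.val + 1 = 1 then (1 : L) else 0) v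
  have hK : (((UnitaryGroup.cmLocalIntegralLevel L 2 (Matrix.of fun i j : Fin 2 => if i.val + j.val + 1 = 2 then (1 : L) else 0) v).prod
        (UnitaryGroup.cmLocalIntegralLevel L 1 (Matrix.of fun i j : Fin 1 => if i.val + j.val + 1 = 1 then (1 : L) else 0) v) :
          Subgroup ((UnitaryGroup.cmDatum L 2 (Matrix.of fun i j : Fin 2 => if i.val + j.val + 1 = 2 then (1 : L) else 0)).Local v ×
            (UnitaryGroup.cmDatum L 1 (Matrix.of fun i j : Fin 1 => if i.val + j.val + 1 = 1 then (1 : L) else 0)).Local v)) :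
        Set ((UnitaryGroup.cmDatum L 2 (Matrix.of fun i j : Fin 2 => if i.val + j.val + 1 = 2 then (1 : L) else 0)).Local v ×
          (UnitaryGroup.cmDatum L 1 (Matrix.of fun i j : Fin 1 => if i.val + j.val + 1 = 1 then (1 : L) else 0)).Local v)) =
      (UnitaryGroup.cmLocalIntegralLevel L 2 (Matrix.of fun i j : Fin 2 => if i.val + j.val + 1 = 2 then (1 : L) else 0) v :
          Set ((UnitaryGroup.cmDatum L 2 (Matrix.of fun i j : Fin 2 => if i.val + j.val + 1 = 2 then (1 : L) else 0)).Local v)) ×ˢ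
        (UnitaryGroup.cmLocalIntegralLevel L 1 (Matrix.of fun i j : Fin 1 => if i.val + j.val + 1 = 1 then (1 : L) else 0) v :
          Set ((UnitaryGroup.cmDatum L 1 (Matrix.of fun i j : Fin 1 => if i.val + j.val + 1 = 1 then (1 : L) else 0)).Local v)) :=
    Subgroup.coe_prod _ _
  refine isLocSmooth_indicator_subgroup _ ?_ ?_
  · rw [hK]; exact h₂.2.prod h₁.2
  · rw [hK]; exact h₂.1.prod h₁.1

end Unit

/-! ## §2 The closer: `c_v = 1` off a finite set -/

section Closer

variable (L : Type) [Field L] [NumberField L] [IsCMField L] (H' : Matrix (Fin 3) (Fin 3) L)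
  [∀ (v : HeightOneSpectrum (𝓞 ↥(maximalRealSubfield L))) (γ : (UnitaryGroup.cmDatum L 3 H').Local v),
    MeasurableSpace ((UnitaryGroup.cmDatum L 3 H').Local v ⧸ Subgroup.centralizer ({γ} : Set ((UnitaryGroup.cmDatum L 3 H').Local v)))]
  [∀ (v : HeightOneSpectrum (𝓞 ↥(maximalRealSubfield L))) (γ : (UnitaryGroup.cmDatum L 3 H').Local v),
    BorelSpace ((UnitaryGroup.cmDatum L 3 H').Local v ⧸ Subgroup.centralizer ({γ} : Set ((UnitaryGroup.cmDatum L 3 H').Local v)))]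
  [∀ (v : HeightOneSpectrum (𝓞 ↥(maximalRealSubfield L))) (a : ((UnitaryGroup.cmDatum L 2 (Matrix.of fun i j : Fin 2 => if i.val + j.val + 1 = 2 then (1 : L) else 0)).Local v ×
      (UnitaryGroup.cmDatum L 1 (Matrix.of fun i j : Fin 1 => if i.val + j.val + 1 = 1 then (1 : L) else 0)).Local v)),
    MeasurableSpace (((UnitaryGroup.cmDatum L 2 (Matrix.of fun i j : Fin 2 => if i.val + j.val + 1 = 2 then (1 : L) else 0)).Local v ×
      (UnitaryGroup.cmDatum L 1 (Matrix.of fun i j : Fin 1 => if i.val + j.val + 1 = 1 then (1 : L) else 0)).Local v) ⧸ Subgroup.centralizer ({a} : Set ((UnitaryGroup.cmDatum L 2 (Matrix.of fun i j : Fin 2 => if i.val + j.val + 1 = 2 then (1 : L) else 0)).Local v ×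
      (UnitaryGroup.cmDatum L 1 (Matrix.of fun i j : Fin 1 => if i.val + j.val + 1 = 1 then (1 : L) else 0)).Local v)))]

/-- **P4 `stub_kappaConst_ae_one` — the κ-constant of (κ-loc) is `1` at almost every place.**  `H′` hermitian anisotropic (the line's guards `hherm hanis`);
`(Sbad, Δ, mH, mG)` the opened REGULAR transfer data of ★ `SingularEllipticTransferCanonical` with the UNIT FUNDAMENTAL LEMMA off `Sbad`
(`hunit : ∀ v ∉ Sbad, IsLocalUnitTransfer L H′ v (Δ v) (mH v) (mG v)` — conjunct `(·.1 v).2.1` of ★ `CanonicalTransferMatrix`); singular members `mGs` admissible on the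
local classes corresponding to `(γ₀)_v` ((ADM) :203 first conjunct at `γ₀`, VERBATIM) and normalised off a finite set at `toAdelic γ₀` ((NORM) :216 at `γ₀`, VERBATIM);
`γ_H ∈ H(L⁺)` any rational pair; `c : v ↦ ℂ` with the (κ-loc) letter `hloc` (P3's hypothesis text).  THEN `∃ S_c, ∀ v ∉ S_c, c v = 1` — P3 `stub_kappaMass_glue`'s
binders `(Sc) (hae)`. [cite: Rogawski1990, §4.9 Prop. 4.9.1 (b) p. 55 («(3) `+1` for almost all `v`»); §8.2 Prop. 8.2.1 (a) pp. 117–118; §8.3 Prop. 8.3.1 p. 121; §14.5 L. 14.5.2 (b) p. 239]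
[cite: Kottwitz1986, Prop. 7.1, Cor. 7.3] -/
theorem kappaConst_ae_one
    (hherm : (H'.map (cmConjRingHom L)).transpose = H')
    (hanis : ∀ x : Fin 3 → L, hermForm (cmConjRingHom L) H' x x = 0 → x = 0)
    (Sbad : Finset (HeightOneSpectrum (𝓞 ↥(maximalRealSubfield L))))
    (Δ : ∀ v : HeightOneSpectrum (𝓞 ↥(maximalRealSubfield L)), LocalTransferFactor L H' v)
    (mH : ∀ v : HeightOneSpectrum (𝓞 ↥(maximalRealSubfield L)),
      OrbitalMeasureFamily ((UnitaryGroup.cmDatum L 2 (Matrix.of fun i j : Fin 2 => if i.val + j.val + 1 = 2 then (1 : L) else 0)).Local v ×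
        (UnitaryGroup.cmDatum L 1 (Matrix.of fun i j : Fin 1 => if i.val + j.val + 1 = 1 then (1 : L) else 0)).Local v))
    (mG : ∀ v : HeightOneSpectrum (𝓞 ↥(maximalRealSubfield L)), OrbitalMeasureFamily ((UnitaryGroup.cmDatum L 3 H').Local v))
    (hunit : ∀ v, v ∉ Sbad → IsLocalUnitTransfer L H' v (Δ v) (mH v) (mG v))
    (mGs : ∀ v : HeightOneSpectrum (𝓞 ↥(maximalRealSubfield L)), OrbitalMeasureFamily ((UnitaryGroup.cmDatum L 3 H').Local v))
    (γ₀ : (UnitaryGroup.cmDatum L 3 H').Rational)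
    (γH : (UnitaryGroup.cmDatum L 2 (Matrix.of fun i j : Fin 2 => if i.val + j.val + 1 = 2 then (1 : L) else 0)).Rational ×
      (UnitaryGroup.cmDatum L 1 (Matrix.of fun i j : Fin 1 => if i.val + j.val + 1 = 1 then (1 : L) else 0)).Rational)
    (hadm : ∀ v, (mGs v).IsAdmissibleOn fun x : (UnitaryGroup.cmDatum L 3 H').Local v =>
      Corresponds (UnitaryGroup.conjLocal L (IsCMField.complexConj L) v)
        ((UnitaryGroup.adelicForm L 3 H').map (UnitaryGroup.adeleToLocal L v))
        ((UnitaryGroup.adelicForm L 3 H').map (UnitaryGroup.adeleToLocal L v))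
        ((UnitaryGroup.cmDatum L 3 H').toLocal v ((UnitaryGroup.cmDatum L 3 H').toAdelic γ₀)) x)
    (hnormγ : ∃ S₀ : Finset (HeightOneSpectrum (𝓞 ↥(maximalRealSubfield L))),
      UnitaryGroup.IsNormalisedOff L 3 H' mGs ((UnitaryGroup.cmDatum L 3 H').toAdelic γ₀) S₀)
    (c : HeightOneSpectrum (𝓞 ↥(maximalRealSubfield L)) → ℂ)
    (hloc : ∀ (v : HeightOneSpectrum (𝓞 ↥(maximalRealSubfield L)))
      (fH : (UnitaryGroup.cmDatum L 2 (Matrix.of fun i j : Fin 2 => if i.val + j.val + 1 = 2 then (1 : L) else 0)).Local v ×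
          (UnitaryGroup.cmDatum L 1 (Matrix.of fun i j : Fin 1 => if i.val + j.val + 1 = 1 then (1 : L) else 0)).Local v → ℂ)
      (f : (UnitaryGroup.cmDatum L 3 H').Local v → ℂ),
      IsLocSmooth f → IsLocSmooth fH → IsLocalDeltaTransfer L H' v (Δ v) (mH v) (mG v) fH f →
        localStableOrbitalIntegral L 3 H' v (mGs v) f ((UnitaryGroup.cmDatum L 3 H').toLocal v ((UnitaryGroup.cmDatum L 3 H').toAdelic γ₀)) =
          c v * fH ((UnitaryGroup.cmDatum L 2 (Matrix.of fun i j : Fin 2 => if i.val + j.val + 1 = 2 then (1 : L) else 0)).toLocal v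
              ((UnitaryGroup.cmDatum L 2 (Matrix.of fun i j : Fin 2 => if i.val + j.val + 1 = 2 then (1 : L) else 0)).toAdelic γH.1),
            (UnitaryGroup.cmDatum L 1 (Matrix.of fun i j : Fin 1 => if i.val + j.val + 1 = 1 then (1 : L) else 0)).toLocal v
              ((UnitaryGroup.cmDatum L 1 (Matrix.of fun i j : Fin 1 => if i.val + j.val + 1 = 1 then (1 : L) else 0)).toAdelic γH.2))) :
    ∃ S_c : Finset (HeightOneSpectrum (𝓞 ↥(maximalRealSubfield L))), ∀ v, v ∉ S_c → c v = 1 := by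
  -- (1) the unramified local STABLE unit factor at the (semisimple) class of `γ₀` is `1` a.e. (★ brick)
  have hγ : Corresponds (cmConjRingHom L) H' H' γ₀ γ₀ := corresponds_self_iff.2 (IsStablyConj.refl _)
  obtain ⟨S₀, hS₀⟩ := hnormγ
  have h1 := eventually_localStableOrbitalIntegral_indicator_eq_one_of_isSemisimpleElt L H' mGs hherm
    (Godement.det_ne_zero_of_anisotropic L H' hanis) γ₀ (isSemisimpleElt_of_anisotropic (cmConjRingHom L) H' hanis _)
    (fun v => (hadm v _ ((corresponds_toLocal_toAdelic hγ v).of_isStablyConj_right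
      (isStablyConj_of_isConj (isConj_out_conjClasses_mk _)))).2.1) hS₀
  -- (2) `(γ_H)_v` is integral a.e.; `v ∉ Sbad` a.e.; read (κ-loc) at the unit pair there
  have h : ∀ᶠ v in cofinite, c v = 1 := by
    filter_upwards [h1,
      eventually_toLocal_mem_cmLocalIntegralLevel
        ((UnitaryGroup.cmDatum L 2 (Matrix.of fun i j : Fin 2 => if i.val + j.val + 1 = 2 then (1 : L) else 0)).toAdelic γH.1),
      eventually_toLocal_mem_cmLocalIntegralLevel
        ((UnitaryGroup.cmDatum L 1 (Matrix.of fun i j : Fin 1 => if i.val + j.val + 1 = 1 then (1 : L) else 0)).toAdelic γH.2),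
      Sbad.eventually_cofinite_notMem] with v hv1 hv₂ hv₁ hvS
    have key := hloc v _ _ (isLocSmooth_indicator_cmLocalIntegralLevel L 3 H' v) (isLocSmooth_indicator_prod_cmLocalIntegralLevel L v) (hunit v hvS)
    rw [hv1, Set.indicator_of_mem (SetLike.mem_coe.2 (Subgroup.mem_prod.2 ⟨hv₂, hv₁⟩)), mul_one] at key
    exact key.symm
  refine ⟨(Filter.eventually_cofinite.1 h).toFinset, fun v hv => ?_⟩
  by_contra hc
  exact hv ((Set.Finite.mem_toFinset _).2 hc)

end Closer

/-! ## §3 The same over the line's binder `hCTM : CanonicalTransferMatrix …` -/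

section Canonical

variable (L : Type) [Field L] [NumberField L] [IsCMField L] (H' : Matrix (Fin 3) (Fin 3) L) (Tinf : ArchTransferFactor L H')
  [∀ v : HeightOneSpectrum (𝓞 ↥(maximalRealSubfield L)),
    MeasurableSpace ((UnitaryGroup.cmDatum L 2 (Matrix.of fun i j : Fin 2 => if i.val + j.val + 1 = 2 then (1 : L) else 0)).Local v ×
      (UnitaryGroup.cmDatum L 1 (Matrix.of fun i j : Fin 1 => if i.val + j.val + 1 = 1 then (1 : L) else 0)).Local v)]
  [∀ v : HeightOneSpectrum (𝓞 ↥(maximalRealSubfield L)),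
    BorelSpace ((UnitaryGroup.cmDatum L 2 (Matrix.of fun i j : Fin 2 => if i.val + j.val + 1 = 2 then (1 : L) else 0)).Local v ×
      (UnitaryGroup.cmDatum L 1 (Matrix.of fun i j : Fin 1 => if i.val + j.val + 1 = 1 then (1 : L) else 0)).Local v)]
  [∀ v : HeightOneSpectrum (𝓞 ↥(maximalRealSubfield L)), MeasurableSpace ((UnitaryGroup.cmDatum L 3 H').Local v)]
  [∀ v : HeightOneSpectrum (𝓞 ↥(maximalRealSubfield L)), BorelSpace ((UnitaryGroup.cmDatum L 3 H').Local v)]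
  (νH : ∀ v : HeightOneSpectrum (𝓞 ↥(maximalRealSubfield L)),
    Measure ((UnitaryGroup.cmDatum L 2 (Matrix.of fun i j : Fin 2 => if i.val + j.val + 1 = 2 then (1 : L) else 0)).Local v ×
      (UnitaryGroup.cmDatum L 1 (Matrix.of fun i j : Fin 1 => if i.val + j.val + 1 = 1 then (1 : L) else 0)).Local v))
  (νG : ∀ v : HeightOneSpectrum (𝓞 ↥(maximalRealSubfield L)), Measure ((UnitaryGroup.cmDatum L 3 H').Local v))
  [∀ v, IsFiniteMeasureOnCompacts (νH v)] [∀ v, (νH v).IsMulRightInvariant]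
  [∀ v, IsFiniteMeasureOnCompacts (νG v)] [∀ v, (νG v).IsMulRightInvariant]
  [∀ (v : HeightOneSpectrum (𝓞 ↥(maximalRealSubfield L))) (a : ((UnitaryGroup.cmDatum L 2 (Matrix.of fun i j : Fin 2 => if i.val + j.val + 1 = 2 then (1 : L) else 0)).Local v ×
      (UnitaryGroup.cmDatum L 1 (Matrix.of fun i j : Fin 1 => if i.val + j.val + 1 = 1 then (1 : L) else 0)).Local v)),
    MeasurableSpace (((UnitaryGroup.cmDatum L 2 (Matrix.of fun i j : Fin 2 => if i.val + j.val + 1 = 2 then (1 : L) else 0)).Local v ×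
      (UnitaryGroup.cmDatum L 1 (Matrix.of fun i j : Fin 1 => if i.val + j.val + 1 = 1 then (1 : L) else 0)).Local v) ⧸ Subgroup.centralizer ({a} : Set ((UnitaryGroup.cmDatum L 2 (Matrix.of fun i j : Fin 2 => if i.val + j.val + 1 = 2 then (1 : L) else 0)).Local v ×
      (UnitaryGroup.cmDatum L 1 (Matrix.of fun i j : Fin 1 => if i.val + j.val + 1 = 1 then (1 : L) else 0)).Local v)))]
  [∀ (v : HeightOneSpectrum (𝓞 ↥(maximalRealSubfield L))) (a : ((UnitaryGroup.cmDatum L 2 (Matrix.of fun i j : Fin 2 => if i.val + j.val + 1 = 2 then (1 : L) else 0)).Local v ×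
      (UnitaryGroup.cmDatum L 1 (Matrix.of fun i j : Fin 1 => if i.val + j.val + 1 = 1 then (1 : L) else 0)).Local v)),
    BorelSpace (((UnitaryGroup.cmDatum L 2 (Matrix.of fun i j : Fin 2 => if i.val + j.val + 1 = 2 then (1 : L) else 0)).Local v ×
      (UnitaryGroup.cmDatum L 1 (Matrix.of fun i j : Fin 1 => if i.val + j.val + 1 = 1 then (1 : L) else 0)).Local v) ⧸ Subgroup.centralizer ({a} : Set ((UnitaryGroup.cmDatum L 2 (Matrix.of fun i j : Fin 2 => if i.val + j.val + 1 = 2 then (1 : L) else 0)).Local v ×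
      (UnitaryGroup.cmDatum L 1 (Matrix.of fun i j : Fin 1 => if i.val + j.val + 1 = 1 then (1 : L) else 0)).Local v)))]
  [∀ (v : HeightOneSpectrum (𝓞 ↥(maximalRealSubfield L))) (γ : (UnitaryGroup.cmDatum L 3 H').Local v),
    MeasurableSpace ((UnitaryGroup.cmDatum L 3 H').Local v ⧸ Subgroup.centralizer ({γ} : Set ((UnitaryGroup.cmDatum L 3 H').Local v)))]
  [∀ (v : HeightOneSpectrum (𝓞 ↥(maximalRealSubfield L))) (γ : (UnitaryGroup.cmDatum L 3 H').Local v),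
    BorelSpace ((UnitaryGroup.cmDatum L 3 H').Local v ⧸ Subgroup.centralizer ({γ} : Set ((UnitaryGroup.cmDatum L 3 H').Local v)))]

/-- **P4 over the line's binder `hCTM`** — ★ `kappaConst_ae_one` with the unit fundamental lemma read off ★ `CanonicalTransferMatrix L H′ Tinf.Δ νH νG Sbad Δ mH mG`
(its conjunct `v ∉ Sbad → IsLocalUnitTransfer L H′ v (Δ v) (mH v) (mG v)`), the MATRIX the T6-L5 line opens from ★ `SingularEllipticTransferCanonical`.
[cite: Rogawski1990, §4.9 Prop. 4.9.1 (b) p. 55; §8.2 Prop. 8.2.1 (a) pp. 117–118; §8.3 Prop. 8.3.1 p. 121] [cite: Kottwitz1986, Prop. 7.1, Cor. 7.3] -/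
theorem kappaConst_ae_one_of_canonicalTransferMatrix
    (hherm : (H'.map (cmConjRingHom L)).transpose = H')
    (hanis : ∀ x : Fin 3 → L, hermForm (cmConjRingHom L) H' x x = 0 → x = 0)
    (Sbad : Finset (HeightOneSpectrum (𝓞 ↥(maximalRealSubfield L))))
    (Δ : ∀ v : HeightOneSpectrum (𝓞 ↥(maximalRealSubfield L)), LocalTransferFactor L H' v)
    (mH : ∀ v : HeightOneSpectrum (𝓞 ↥(maximalRealSubfield L)),
      OrbitalMeasureFamily ((UnitaryGroup.cmDatum L 2 (Matrix.of fun i j : Fin 2 => if i.val + j.val + 1 = 2 then (1 : L) else 0)).Local v ×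
        (UnitaryGroup.cmDatum L 1 (Matrix.of fun i j : Fin 1 => if i.val + j.val + 1 = 1 then (1 : L) else 0)).Local v))
    (mG : ∀ v : HeightOneSpectrum (𝓞 ↥(maximalRealSubfield L)), OrbitalMeasureFamily ((UnitaryGroup.cmDatum L 3 H').Local v))
    (hCTM : CanonicalTransferMatrix L H' Tinf.Δ νH νG Sbad Δ mH mG)
    (mGs : ∀ v : HeightOneSpectrum (𝓞 ↥(maximalRealSubfield L)), OrbitalMeasureFamily ((UnitaryGroup.cmDatum L 3 H').Local v))
    (γ₀ : (UnitaryGroup.cmDatum L 3 H').Rational)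
    (γH : (UnitaryGroup.cmDatum L 2 (Matrix.of fun i j : Fin 2 => if i.val + j.val + 1 = 2 then (1 : L) else 0)).Rational ×
      (UnitaryGroup.cmDatum L 1 (Matrix.of fun i j : Fin 1 => if i.val + j.val + 1 = 1 then (1 : L) else 0)).Rational)
    (hadm : ∀ v, (mGs v).IsAdmissibleOn fun x : (UnitaryGroup.cmDatum L 3 H').Local v =>
      Corresponds (UnitaryGroup.conjLocal L (IsCMField.complexConj L) v)
        ((UnitaryGroup.adelicForm L 3 H').map (UnitaryGroup.adeleToLocal L v))
        ((UnitaryGroup.adelicForm L 3 H').map (UnitaryGroup.adeleToLocal L v))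
        ((UnitaryGroup.cmDatum L 3 H').toLocal v ((UnitaryGroup.cmDatum L 3 H').toAdelic γ₀)) x)
    (hnormγ : ∃ S₀ : Finset (HeightOneSpectrum (𝓞 ↥(maximalRealSubfield L))),
      UnitaryGroup.IsNormalisedOff L 3 H' mGs ((UnitaryGroup.cmDatum L 3 H').toAdelic γ₀) S₀)
    (c : HeightOneSpectrum (𝓞 ↥(maximalRealSubfield L)) → ℂ)
    (hloc : ∀ (v : HeightOneSpectrum (𝓞 ↥(maximalRealSubfield L)))
      (fH : (UnitaryGroup.cmDatum L 2 (Matrix.of fun i j : Fin 2 => if i.val + j.val + 1 = 2 then (1 : L) else 0)).Local v ×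
          (UnitaryGroup.cmDatum L 1 (Matrix.of fun i j : Fin 1 => if i.val + j.val + 1 = 1 then (1 : L) else 0)).Local v → ℂ)
      (f : (UnitaryGroup.cmDatum L 3 H').Local v → ℂ),
      IsLocSmooth f → IsLocSmooth fH → IsLocalDeltaTransfer L H' v (Δ v) (mH v) (mG v) fH f →
        localStableOrbitalIntegral L 3 H' v (mGs v) f ((UnitaryGroup.cmDatum L 3 H').toLocal v ((UnitaryGroup.cmDatum L 3 H').toAdelic γ₀)) =
          c v * fH ((UnitaryGroup.cmDatum L 2 (Matrix.of fun i j : Fin 2 => if i.val + j.val + 1 = 2 then (1 : L) else 0)).toLocal v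
              ((UnitaryGroup.cmDatum L 2 (Matrix.of fun i j : Fin 2 => if i.val + j.val + 1 = 2 then (1 : L) else 0)).toAdelic γH.1),
            (UnitaryGroup.cmDatum L 1 (Matrix.of fun i j : Fin 1 => if i.val + j.val + 1 = 1 then (1 : L) else 0)).toLocal v
              ((UnitaryGroup.cmDatum L 1 (Matrix.of fun i j : Fin 1 => if i.val + j.val + 1 = 1 then (1 : L) else 0)).toAdelic γH.2))) :
    ∃ S_c : Finset (HeightOneSpectrum (𝓞 ↥(maximalRealSubfield L))), ∀ v, v ∉ S_c → c v = 1 :=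
  kappaConst_ae_one L H' hherm hanis Sbad Δ mH mG (fun v hv => (hCTM.1 v).2.1 hv) mGs γ₀ γH hadm hnormγ c hloc

end Canonical

end Literature.NumberTheory.Rogawski1990

end
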